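import Summits.MatrixMultiplication.OmegaCensus.TriangleTorusShearedTwoThirds
import Summits.MatrixMultiplication.OmegaCensus.ThreeSetTilingPartThreeSharp

/-!
# A part of size three forces `|A| ≤ 6·ord(w' − w) + 4`: the index of every difference vector is `1, 2, 4` or `5` (kernel)

ω-census `pub-omega`, family (b3), seat pub-omega-group gen 35.  Framing: lottery ticket; floor = certified bounds/negative
ranges.  VALUE: the all-`A` theorem of `ThreeSetTilingPartThreeSharp` (`|A| + 3 ≤ 8·ord`) sharpened to `|A| ≤ 6·ord + 4` by the
amortised imbalance bound `TriangleTorusShearedTwoThirds.imbalance_le_two_thirds` (`54·Δ ≤ 36n + 18`); NOT progress on ω; no census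
word changes.  Newly KERNEL (were ENGINE / computational NONE): the `|W| = 3` cells of every finite abelian `A` with
`6·exp(A) + 5 ≤ |A|`, e.g. `ℤ_7 × ℤ_49` (cells `(3,1,38)`, `(3,2,19)` @ 343) and `ℤ_7 × ℤ_112` (`(3,1,87)`, `(3,3,29)` @ 784), and the
whole family `ℤ_m × ℤ_l`, `m ∣ l`, `m ≥ 7`.

* `card_sub_card_bound_six` — bridge: `54·(#T − #M) ≤ 36·ord v + 18` for a triangle tiling pulled back along `(c, j) ↦ c•u + j•v`.
* **`card_le_of_tiling_part_three_six`** — a 2:1 tiling of `A ∖ {z₀}` by translates of `±W`, `|W| = 3`, forces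
  `|A| ≤ 6 · addOrderOf (w' − w) + 4` for any two distinct `w, w' ∈ W`; the same for a part of size `3` of a cube SYMMETRIC form
  (`card_le_of_cube_form_part_three_six`) and of a cube SHIFTED form (`card_le_of_shifted_form_part_three_six`).
* **`index_le_six_of_tiling_part_three`** — in that situation the index `|A| / ord(w' − w)` is at most `6` as soon as
  `ord(w' − w) ≥ 5`; since `3 ∤ |A|`, the index is then `1, 2, 4` or `5` (`index_mem_of_tiling_part_three`).  This is the exact
  reach of one-column information (RESULTS-g34 §2, RESULTS-g35): the open indices are `4` and `5`.
* `cube_form_no_part_three_of_addOrderOf_le_six` / `…_of_exponent_six` — all orders `≤ e` with `6e + 4 < |A|` ⇒ no part of size `3`;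
  **`cube_form_no_part_three_zmod_prod`** — over `ℤ_m × ℤ_l` with `m ∣ l`, `7 ≤ m`: no part of size `3`.
* The law corollaries (dihedral-like `G`, TPP triples attaining `3|S||T||U| + 8 = 8|A|`) are drawn in the sequel
  `CubeLawNoCosetPartThreeSix`.
-/

namespace Summit.MatrixMultiplication.OmegaCensus

open Finset TriangleTorus

section Bridge

variable {A : Type*} [AddCommGroup A] [DecidableEq A] [Fintype A]

/-- **Bridge, constant six.**  For a triangle tiling of `A ∖ {z₀}` by translates of `±{0, u, v}` (`u, v` generating `A`,
`3 ∤ ord v`): `54·(#T − #M) ≤ 36·ord v + 18`. [folklore] -/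
theorem card_sub_card_bound_six (u v : A) (hu : u ≠ 0) (hv : v ≠ 0) (huv : u ≠ v)
    (hgen : ∀ x : A, ∃ i k : ℤ, i • u + k • v = x) (h3 : ¬ 3 ∣ addOrderOf v) (T M : Finset A) (z₀ : A)
    (h : ∀ x, (M.filter fun m => m - x ∈ ({0, u, v} : Finset A)).card +
      (T.filter fun t => x - t ∈ ({0, u, v} : Finset A)).card = if x = z₀ then 0 else 1) :
    54 * ((T.card : ℤ) - M.card) ≤ 36 * addOrderOf v + 18 := by
  classical
  have hex : ∃ a : ℕ, 0 < a ∧ (a : ℤ) • u ∈ AddSubgroup.zmultiples v :=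
    ⟨addOrderOf u, addOrderOf_pos u, by rw [natCast_zsmul, addOrderOf_nsmul_eq_zero]; exact AddSubgroup.zero_mem _⟩
  obtain ⟨ha, hamem⟩ := Nat.find_spec hex
  set a := Nat.find hex with ha_def
  have hmin : ∀ b : ℕ, 0 < b → (b : ℤ) • u ∈ AddSubgroup.zmultiples v → a ≤ b :=
    fun b hb hbm => Nat.find_min' hex ⟨hb, hbm⟩
  obtain ⟨k, hk⟩ := AddSubgroup.mem_zmultiples_iff.1 hamem
  have has : (a : ℤ) • u + (-k) • v = 0 := by rw [← hk, neg_zsmul, add_neg_cancel]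
  have ha0 : (0 : ℤ) < a := by exact_mod_cast ha
  have hdiv : ∀ c : ℤ, c • u ∈ AddSubgroup.zmultiples v → (a : ℤ) ∣ c := by
    intro c hc
    have hr : (c % a) • u ∈ AddSubgroup.zmultiples v := by
      rw [show c % a = c - (c / a) * a by rw [Int.emod_def]; ring, sub_zsmul, mul_zsmul]
      exact add_mem hc (neg_mem (AddSubgroup.zsmul_mem _ hamem _))
    by_contra hnd
    have hr0 : c % a ≠ 0 := fun h0 => hnd (Int.dvd_of_emod_eq_zero h0)
    have hrpos : 0 < c % a := lt_of_le_of_ne (Int.emod_nonneg _ ha0.ne') (Ne.symm hr0)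
    have hrlt : c % a < a := Int.emod_lt_of_pos _ ha0
    have hle := hmin (c % a).toNat (by omega) (by rwa [Int.toNat_of_nonneg hrpos.le])
    omega
  have hdiv' : ∀ c j : ℤ, c • u + j • v = 0 → (a : ℤ) ∣ c := fun c j hcj =>
    hdiv c (AddSubgroup.mem_zmultiples_iff.2 ⟨-j, by rw [neg_zsmul]; exact neg_eq_of_add_eq_zero_left hcj⟩)
  set F := shearedFactorOfFinsets u v a (-k) T M z₀ hu hv huv has hdiv' h with hF
  have hup : F.upCount = T.card := by
    unfold ShearedFactor.upCount
    simp only [hF, shearedFactorOfFinsets, decide_eq_true_eq]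
    exact sum_sum_indicator_sheared u v z₀ a (-k) ha has hdiv hgen T
  have hdn : F.dnCount = M.card := by
    unfold ShearedFactor.dnCount
    simp only [hF, shearedFactorOfFinsets, decide_eq_true_eq]
    exact sum_sum_indicator_sheared u v z₀ a (-k) ha has hdiv hgen M
  have hhole : F.hole 0 0 = true := by simp [hF, shearedFactorOfFinsets]
  have hn2 : 2 ≤ addOrderOf v := by
    have h1 : addOrderOf v ≠ 1 := fun h1 => hv (AddMonoid.addOrderOf_eq_one_iff.1 h1)
    have h0 := addOrderOf_pos v
    omega
  have := F.imbalance_le_two_thirds h3 hn2 ha 0 hhole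
  rwa [hup, hdn] at this

/-- **Main theorem, constant six (tiling form).**  If translates `m − W` (`m ∈ M`) and `t + W` (`t ∈ T`) of a three-element
set `W` partition `A ∖ {z₀}` with `|T| = 2|M|`, then `|A| ≤ 6 · addOrderOf (w' − w) + 4` for any two distinct `w, w' ∈ W`.
[folklore] -/
theorem card_le_of_tiling_part_three_six {W T M : Finset A} {z₀ : A}
    (h : ∀ a, (M.filter fun m => m - a ∈ W).card + (T.filter fun t => a - t ∈ W).card = if a = z₀ then 0 else 1)
    (hW : W.card = 3) (hTM : T.card = 2 * M.card) {w w' : A} (hw : w ∈ W) (hw' : w' ∈ W) (hne : w ≠ w') :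
    Fintype.card A ≤ 6 * addOrderOf (w' - w) + 4 := by
  classical
  obtain ⟨w'', hw''W, hw''w, hw''w'⟩ : ∃ w'' ∈ W, w'' ≠ w ∧ w'' ≠ w' := by
    have hc : ((W.erase w).erase w').card = 1 := by
      rw [card_erase_of_mem (mem_erase.2 ⟨hne.symm, hw'⟩), card_erase_of_mem hw, hW]
    obtain ⟨w'', hw''⟩ := card_eq_one.1 hc
    have hm : w'' ∈ (W.erase w).erase w' := by rw [hw'']; exact mem_singleton_self _
    exact ⟨w'', (mem_erase.1 (mem_erase.1 hm).2).2, (mem_erase.1 (mem_erase.1 hm).2).1, (mem_erase.1 hm).1⟩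
  set u : A := w'' - w with hu_def
  set v : A := w' - w with hv_def
  have hWeq : W = {w, w + u, w + v} := by
    rw [eq_triple_of_card_three hW hw hw''W hw' hw''w.symm hne hw''w', hu_def, hv_def, add_sub_cancel, add_sub_cancel]
  have hu : u ≠ 0 := sub_ne_zero.2 hw''w
  have hv : v ≠ 0 := sub_ne_zero.2 hne.symm
  have huv : u ≠ v := fun e => hw''w' (sub_left_injective e)
  have h' := tiling_recentre hWeq h
  have hgen' := closure_eq_top_of_tiling hu hv huv h'
  have hgen : ∀ x : A, ∃ i k : ℤ, i • u + k • v = x := fun x =>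
    AddSubgroup.mem_closure_pair.1 (by rw [hgen']; exact AddSubgroup.mem_top x)
  have hcount := tiling_count hu hv huv h'
  rw [card_image_of_injective _ (sub_left_injective), card_image_of_injective _ (add_left_injective w), hTM] at hcount
  have h3 : ¬ 3 ∣ addOrderOf v := by
    intro h3
    have : 3 ∣ Fintype.card A := h3.trans addOrderOf_dvd_card
    omega
  have hb := card_sub_card_bound_six u v hu hv huv hgen h3 _ _ _ h'
  rw [card_image_of_injective _ (sub_left_injective), card_image_of_injective _ (add_left_injective w), hTM,
    Nat.cast_mul, show ((2 : ℕ) : ℤ) * (M.card : ℤ) - M.card = M.card by ring] at hb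
  have hc' : (3 * (M.card + 2 * M.card) + 1 : ℤ) = Fintype.card A := by exact_mod_cast hcount
  have : (Fintype.card A : ℤ) ≤ 6 * addOrderOf v + 4 := by linarith
  exact_mod_cast this

/-- **Index form.**  In the situation of `card_le_of_tiling_part_three_six`, if `ord(w' − w) ≥ 5` then
`|A| < 7 · ord(w' − w)`, i.e. the index of `⟨w' − w⟩` in `A` is at most `6`. [folklore] -/
theorem index_le_six_of_tiling_part_three {W T M : Finset A} {z₀ : A}
    (h : ∀ a, (M.filter fun m => m - a ∈ W).card + (T.filter fun t => a - t ∈ W).card = if a = z₀ then 0 else 1)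
    (hW : W.card = 3) (hTM : T.card = 2 * M.card) {w w' : A} (hw : w ∈ W) (hw' : w' ∈ W) (hne : w ≠ w')
    (h5 : 5 ≤ addOrderOf (w' - w)) : Fintype.card A / addOrderOf (w' - w) ≤ 6 := by
  have h := card_le_of_tiling_part_three_six h hW hTM hw hw' hne
  have hlt : Fintype.card A < 7 * addOrderOf (w' - w) := by omega
  exact Nat.lt_succ_iff.1 ((Nat.div_lt_iff_lt_mul (by omega)).2 (by linarith))

/-- **The index is `1, 2, 4` or `5`.**  In the situation of `card_le_of_tiling_part_three_six` with `ord(w' − w) ≥ 5`, the index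
`[A : ⟨w' − w⟩] = |A| / ord(w' − w)` lies in `{1, 2, 4, 5}` (it divides `|A| = 9|M| + 1`, which is prime to `3`, and is `≤ 6`).
[folklore] -/
theorem index_mem_of_tiling_part_three {W T M : Finset A} {z₀ : A}
    (h : ∀ a, (M.filter fun m => m - a ∈ W).card + (T.filter fun t => a - t ∈ W).card = if a = z₀ then 0 else 1)
    (hW : W.card = 3) (hTM : T.card = 2 * M.card) {w w' : A} (hw : w ∈ W) (hw' : w' ∈ W) (hne : w ≠ w')
    (h5 : 5 ≤ addOrderOf (w' - w)) :
    Fintype.card A / addOrderOf (w' - w) ∈ ({1, 2, 4, 5} : Finset ℕ) := by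
  classical
  have hle := index_le_six_of_tiling_part_three h hW hTM hw hw' hne h5
  have hdvd : addOrderOf (w' - w) ∣ Fintype.card A := addOrderOf_dvd_card
  obtain ⟨q, hq⟩ := hdvd
  have hpos : 0 < addOrderOf (w' - w) := addOrderOf_pos _
  have hq' : Fintype.card A / addOrderOf (w' - w) = q := by
    rw [hq, Nat.mul_div_cancel_left _ hpos]
  rw [hq'] at hle ⊢
  -- `3 ∤ |A|` from the counting identity `9|M| + 1 = |A|`
  obtain ⟨w'', hw''W, hw''w, hw''w'⟩ : ∃ w'' ∈ W, w'' ≠ w ∧ w'' ≠ w' := by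
    have hc : ((W.erase w).erase w').card = 1 := by
      rw [card_erase_of_mem (mem_erase.2 ⟨hne.symm, hw'⟩), card_erase_of_mem hw, hW]
    obtain ⟨w'', hw''⟩ := card_eq_one.1 hc
    have hm : w'' ∈ (W.erase w).erase w' := by rw [hw'']; exact mem_singleton_self _
    exact ⟨w'', (mem_erase.1 (mem_erase.1 hm).2).2, (mem_erase.1 (mem_erase.1 hm).2).1, (mem_erase.1 hm).1⟩
  have hWeq : W = {w, w + (w'' - w), w + (w' - w)} := by
    rw [eq_triple_of_card_three hW hw hw''W hw' hw''w.symm hne hw''w', add_sub_cancel, add_sub_cancel]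
  have hu : w'' - w ≠ 0 := sub_ne_zero.2 hw''w
  have hv : w' - w ≠ 0 := sub_ne_zero.2 hne.symm
  have huv : w'' - w ≠ w' - w := fun e => hw''w' (sub_left_injective e)
  have hcount := tiling_count hu hv huv (tiling_recentre hWeq h)
  rw [card_image_of_injective _ (sub_left_injective), card_image_of_injective _ (add_left_injective w), hTM] at hcount
  have h3A : ¬ 3 ∣ Fintype.card A := by rw [← hcount]; omega
  have h3 : ¬ 3 ∣ q := fun hq3 => h3A (hq ▸ dvd_mul_of_dvd_right hq3 _)
  have hq0 : q ≠ 0 := by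
    intro h0
    rw [h0, mul_zero] at hq
    exact Fintype.card_ne_zero hq
  simp only [mem_insert, mem_singleton]
  omega

/-- **Constant six for the cube SYMMETRIC form**: `|W| = 3 ⇒ |A| ≤ 6 · addOrderOf (w' − w) + 4`. [folklore] -/
theorem card_le_of_cube_form_part_three_six {W X Y : Finset A} {x₀ : A}
    (h₁ : Set.InjOn (fun p : A × A × A => -p.1 + p.2.1 + p.2.2) ↑(W ×ˢ X ×ˢ Y))
    (h₂ : Set.InjOn (fun p : A × A × A => p.1 - p.2.1 + p.2.2) ↑(W ×ˢ X ×ˢ Y))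
    (h₃ : Set.InjOn (fun p : A × A × A => p.1 + p.2.1 - p.2.2) ↑(W ×ˢ X ×ˢ Y))
    (d₁₂ : Disjoint ((W ×ˢ X ×ˢ Y).image fun p : A × A × A => -p.1 + p.2.1 + p.2.2)
      ((W ×ˢ X ×ˢ Y).image fun p : A × A × A => p.1 - p.2.1 + p.2.2))
    (d₁₃ : Disjoint ((W ×ˢ X ×ˢ Y).image fun p : A × A × A => -p.1 + p.2.1 + p.2.2)
      ((W ×ˢ X ×ˢ Y).image fun p : A × A × A => p.1 + p.2.1 - p.2.2))
    (d₂₃ : Disjoint ((W ×ˢ X ×ˢ Y).image fun p : A × A × A => p.1 - p.2.1 + p.2.2)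
      ((W ×ˢ X ×ˢ Y).image fun p : A × A × A => p.1 + p.2.1 - p.2.2))
    (hcover : ((W ×ˢ X ×ˢ Y).image fun p : A × A × A => -p.1 + p.2.1 + p.2.2) ∪
      ((W ×ˢ X ×ˢ Y).image fun p : A × A × A => p.1 - p.2.1 + p.2.2) ∪
      ((W ×ˢ X ×ˢ Y).image fun p : A × A × A => p.1 + p.2.1 - p.2.2) = univ.erase x₀)
    (hW : W.card = 3) {w w' : A} (hw : w ∈ W) (hw' : w' ∈ W) (hne : w ≠ w') :
    Fintype.card A ≤ 6 * addOrderOf (w' - w) + 4 := by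
  obtain ⟨htile, -, hM, hT⟩ := cube_form_tiling ⟨w, hw⟩ h₁ h₂ h₃ d₁₂ d₁₃ d₂₃ hcover
  exact card_le_of_tiling_part_three_six htile hW (by rw [hT, hM]) hw hw' hne

/-- **Constant six for the cube SHIFTED form** (any parity): `|W| = 3 ⇒ |A| ≤ 6 · addOrderOf (w' − w) + 4`. [folklore] -/
theorem card_le_of_shifted_form_part_three_six {W X Y : Finset A} {κ₁ κ₂ κ₃ x₀ : A}
    (i₁ : Set.InjOn (fun p : A × A × A => p.1 + p.2.1 + p.2.2) ↑((W.image fun w => κ₁ - w) ×ˢ X ×ˢ Y))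
    (i₂ : Set.InjOn (fun p : A × A × A => p.1 + p.2.1 + p.2.2) ↑(W ×ˢ (X.image fun x => κ₂ - x) ×ˢ Y))
    (i₃ : Set.InjOn (fun p : A × A × A => p.1 + p.2.1 + p.2.2) ↑(W ×ˢ X ×ˢ (Y.image fun y => κ₃ - y)))
    (d₁₂ : Disjoint (((W.image fun w => κ₁ - w) ×ˢ X ×ˢ Y).image fun p : A × A × A => p.1 + p.2.1 + p.2.2)
      ((W ×ˢ (X.image fun x => κ₂ - x) ×ˢ Y).image fun p : A × A × A => p.1 + p.2.1 + p.2.2))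
    (d₁₃ : Disjoint (((W.image fun w => κ₁ - w) ×ˢ X ×ˢ Y).image fun p : A × A × A => p.1 + p.2.1 + p.2.2)
      ((W ×ˢ X ×ˢ (Y.image fun y => κ₃ - y)).image fun p : A × A × A => p.1 + p.2.1 + p.2.2))
    (d₂₃ : Disjoint ((W ×ˢ (X.image fun x => κ₂ - x) ×ˢ Y).image fun p : A × A × A => p.1 + p.2.1 + p.2.2)
      ((W ×ˢ X ×ˢ (Y.image fun y => κ₃ - y)).image fun p : A × A × A => p.1 + p.2.1 + p.2.2))
    (hcover : (((W.image fun w => κ₁ - w) ×ˢ X ×ˢ Y).image fun p : A × A × A => p.1 + p.2.1 + p.2.2) ∪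
      ((W ×ˢ (X.image fun x => κ₂ - x) ×ˢ Y).image fun p : A × A × A => p.1 + p.2.1 + p.2.2) ∪
      ((W ×ˢ X ×ˢ (Y.image fun y => κ₃ - y)).image fun p : A × A × A => p.1 + p.2.1 + p.2.2) = univ.erase x₀)
    (hW : W.card = 3) {w w' : A} (hw : w ∈ W) (hw' : w' ∈ W) (hne : w ≠ w') :
    Fintype.card A ≤ 6 * addOrderOf (w' - w) + 4 := by
  obtain ⟨htile, hM, hT⟩ := shifted_form_tiling ⟨w, hw⟩ i₁ i₂ i₃ d₁₂ d₁₃ d₂₃ hcover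
  exact card_le_of_tiling_part_three_six htile hW (by rw [hT, hM]) hw hw' hne

/-- `|W| ≠ 3` in a cube symmetric form when all orders are `≤ e` with `6e + 4 < |A|`. [folklore] -/
theorem cube_form_card_ne_three_six {W X Y : Finset A} {x₀ : A}
    (h₁ : Set.InjOn (fun p : A × A × A => -p.1 + p.2.1 + p.2.2) ↑(W ×ˢ X ×ˢ Y))
    (h₂ : Set.InjOn (fun p : A × A × A => p.1 - p.2.1 + p.2.2) ↑(W ×ˢ X ×ˢ Y))
    (h₃ : Set.InjOn (fun p : A × A × A => p.1 + p.2.1 - p.2.2) ↑(W ×ˢ X ×ˢ Y))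
    (d₁₂ : Disjoint ((W ×ˢ X ×ˢ Y).image fun p : A × A × A => -p.1 + p.2.1 + p.2.2)
      ((W ×ˢ X ×ˢ Y).image fun p : A × A × A => p.1 - p.2.1 + p.2.2))
    (d₁₃ : Disjoint ((W ×ˢ X ×ˢ Y).image fun p : A × A × A => -p.1 + p.2.1 + p.2.2)
      ((W ×ˢ X ×ˢ Y).image fun p : A × A × A => p.1 + p.2.1 - p.2.2))
    (d₂₃ : Disjoint ((W ×ˢ X ×ˢ Y).image fun p : A × A × A => p.1 - p.2.1 + p.2.2)
      ((W ×ˢ X ×ˢ Y).image fun p : A × A × A => p.1 + p.2.1 - p.2.2))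
    (hcover : ((W ×ˢ X ×ˢ Y).image fun p : A × A × A => -p.1 + p.2.1 + p.2.2) ∪
      ((W ×ˢ X ×ˢ Y).image fun p : A × A × A => p.1 - p.2.1 + p.2.2) ∪
      ((W ×ˢ X ×ˢ Y).image fun p : A × A × A => p.1 + p.2.1 - p.2.2) = univ.erase x₀)
    (e : ℕ) (he : ∀ x : A, addOrderOf x ≤ e) (hA : 6 * e + 4 < Fintype.card A) : W.card ≠ 3 := by
  intro hW
  obtain ⟨w, w', w'', hww', -, -, hWeq⟩ := card_eq_three.1 hW
  have hw : w ∈ W := by rw [hWeq]; simp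
  have hw' : w' ∈ W := by rw [hWeq]; simp
  have h := card_le_of_cube_form_part_three_six h₁ h₂ h₃ d₁₂ d₁₃ d₂₃ hcover hW hw hw' hww'
  have := he (w' - w)
  omega

/-- **No part of size three, constant six.**  All orders `≤ e` with `6e + 4 < |A|` ⇒ a cube symmetric form over `A` has no part
of size `3`. [folklore] -/
theorem cube_form_no_part_three_of_addOrderOf_le_six {W X Y : Finset A} {x₀ : A}
    (h₁ : Set.InjOn (fun p : A × A × A => -p.1 + p.2.1 + p.2.2) ↑(W ×ˢ X ×ˢ Y))
    (h₂ : Set.InjOn (fun p : A × A × A => p.1 - p.2.1 + p.2.2) ↑(W ×ˢ X ×ˢ Y))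
    (h₃ : Set.InjOn (fun p : A × A × A => p.1 + p.2.1 - p.2.2) ↑(W ×ˢ X ×ˢ Y))
    (d₁₂ : Disjoint ((W ×ˢ X ×ˢ Y).image fun p : A × A × A => -p.1 + p.2.1 + p.2.2)
      ((W ×ˢ X ×ˢ Y).image fun p : A × A × A => p.1 - p.2.1 + p.2.2))
    (d₁₃ : Disjoint ((W ×ˢ X ×ˢ Y).image fun p : A × A × A => -p.1 + p.2.1 + p.2.2)
      ((W ×ˢ X ×ˢ Y).image fun p : A × A × A => p.1 + p.2.1 - p.2.2))
    (d₂₃ : Disjoint ((W ×ˢ X ×ˢ Y).image fun p : A × A × A => p.1 - p.2.1 + p.2.2)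
      ((W ×ˢ X ×ˢ Y).image fun p : A × A × A => p.1 + p.2.1 - p.2.2))
    (hcover : ((W ×ˢ X ×ˢ Y).image fun p : A × A × A => -p.1 + p.2.1 + p.2.2) ∪
      ((W ×ˢ X ×ˢ Y).image fun p : A × A × A => p.1 - p.2.1 + p.2.2) ∪
      ((W ×ˢ X ×ˢ Y).image fun p : A × A × A => p.1 + p.2.1 - p.2.2) = univ.erase x₀)
    (e : ℕ) (he : ∀ x : A, addOrderOf x ≤ e) (hA : 6 * e + 4 < Fintype.card A) :
    W.card ≠ 3 ∧ X.card ≠ 3 ∧ Y.card ≠ 3 := by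
  obtain ⟨i₁, i₂, i₃, e₁₂, e₁₃, e₂₃, ecov⟩ := cube_symmetric_form_rotate h₁ h₂ h₃ d₁₂ d₁₃ d₂₃ hcover
  obtain ⟨j₁, j₂, j₃, f₁₂, f₁₃, f₂₃, fcov⟩ := cube_symmetric_form_rotate i₁ i₂ i₃ e₁₂ e₁₃ e₂₃ ecov
  exact ⟨cube_form_card_ne_three_six h₁ h₂ h₃ d₁₂ d₁₃ d₂₃ hcover e he hA,
    cube_form_card_ne_three_six i₁ i₂ i₃ e₁₂ e₁₃ e₂₃ ecov e he hA,
    cube_form_card_ne_three_six j₁ j₂ j₃ f₁₂ f₁₃ f₂₃ fcov e he hA⟩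

/-- **Exponent form, constant six.**  `6·exp(A) + 4 < |A|` ⇒ no part of size `3`. [folklore] -/
theorem cube_form_no_part_three_of_exponent_six {W X Y : Finset A} {x₀ : A}
    (h₁ : Set.InjOn (fun p : A × A × A => -p.1 + p.2.1 + p.2.2) ↑(W ×ˢ X ×ˢ Y))
    (h₂ : Set.InjOn (fun p : A × A × A => p.1 - p.2.1 + p.2.2) ↑(W ×ˢ X ×ˢ Y))
    (h₃ : Set.InjOn (fun p : A × A × A => p.1 + p.2.1 - p.2.2) ↑(W ×ˢ X ×ˢ Y))
    (d₁₂ : Disjoint ((W ×ˢ X ×ˢ Y).image fun p : A × A × A => -p.1 + p.2.1 + p.2.2)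
      ((W ×ˢ X ×ˢ Y).image fun p : A × A × A => p.1 - p.2.1 + p.2.2))
    (d₁₃ : Disjoint ((W ×ˢ X ×ˢ Y).image fun p : A × A × A => -p.1 + p.2.1 + p.2.2)
      ((W ×ˢ X ×ˢ Y).image fun p : A × A × A => p.1 + p.2.1 - p.2.2))
    (d₂₃ : Disjoint ((W ×ˢ X ×ˢ Y).image fun p : A × A × A => p.1 - p.2.1 + p.2.2)
      ((W ×ˢ X ×ˢ Y).image fun p : A × A × A => p.1 + p.2.1 - p.2.2))
    (hcover : ((W ×ˢ X ×ˢ Y).image fun p : A × A × A => -p.1 + p.2.1 + p.2.2) ∪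
      ((W ×ˢ X ×ˢ Y).image fun p : A × A × A => p.1 - p.2.1 + p.2.2) ∪
      ((W ×ˢ X ×ˢ Y).image fun p : A × A × A => p.1 + p.2.1 - p.2.2) = univ.erase x₀)
    (hA : 6 * AddMonoid.exponent A + 4 < Fintype.card A) : W.card ≠ 3 ∧ X.card ≠ 3 ∧ Y.card ≠ 3 :=
  cube_form_no_part_three_of_addOrderOf_le_six h₁ h₂ h₃ d₁₂ d₁₃ d₂₃ hcover (AddMonoid.exponent A)
    (fun x => AddMonoid.addOrderOf_le_exponent AddMonoid.ExponentExists.of_finite x) hA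

/-- `|W| ≠ 3` in a three-set shifted form when all orders are `≤ e` with `6e + 4 < |A|`. [folklore] -/
theorem shifted_form_card_ne_three_six {W X Y : Finset A} {κ₁ κ₂ κ₃ x₀ : A}
    (i₁ : Set.InjOn (fun p : A × A × A => p.1 + p.2.1 + p.2.2) ↑((W.image fun w => κ₁ - w) ×ˢ X ×ˢ Y))
    (i₂ : Set.InjOn (fun p : A × A × A => p.1 + p.2.1 + p.2.2) ↑(W ×ˢ (X.image fun x => κ₂ - x) ×ˢ Y))
    (i₃ : Set.InjOn (fun p : A × A × A => p.1 + p.2.1 + p.2.2) ↑(W ×ˢ X ×ˢ (Y.image fun y => κ₃ - y)))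
    (d₁₂ : Disjoint (((W.image fun w => κ₁ - w) ×ˢ X ×ˢ Y).image fun p : A × A × A => p.1 + p.2.1 + p.2.2)
      ((W ×ˢ (X.image fun x => κ₂ - x) ×ˢ Y).image fun p : A × A × A => p.1 + p.2.1 + p.2.2))
    (d₁₃ : Disjoint (((W.image fun w => κ₁ - w) ×ˢ X ×ˢ Y).image fun p : A × A × A => p.1 + p.2.1 + p.2.2)
      ((W ×ˢ X ×ˢ (Y.image fun y => κ₃ - y)).image fun p : A × A × A => p.1 + p.2.1 + p.2.2))
    (d₂₃ : Disjoint ((W ×ˢ (X.image fun x => κ₂ - x) ×ˢ Y).image fun p : A × A × A => p.1 + p.2.1 + p.2.2)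
      ((W ×ˢ X ×ˢ (Y.image fun y => κ₃ - y)).image fun p : A × A × A => p.1 + p.2.1 + p.2.2))
    (hcover : (((W.image fun w => κ₁ - w) ×ˢ X ×ˢ Y).image fun p : A × A × A => p.1 + p.2.1 + p.2.2) ∪
      ((W ×ˢ (X.image fun x => κ₂ - x) ×ˢ Y).image fun p : A × A × A => p.1 + p.2.1 + p.2.2) ∪
      ((W ×ˢ X ×ˢ (Y.image fun y => κ₃ - y)).image fun p : A × A × A => p.1 + p.2.1 + p.2.2) = univ.erase x₀)
    (e : ℕ) (he : ∀ x : A, addOrderOf x ≤ e) (hA : 6 * e + 4 < Fintype.card A) : W.card ≠ 3 := by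
  intro hW
  obtain ⟨w, w', w'', hww', -, -, hWeq⟩ := card_eq_three.1 hW
  have hw : w ∈ W := by rw [hWeq]; simp
  have hw' : w' ∈ W := by rw [hWeq]; simp
  have h := card_le_of_shifted_form_part_three_six i₁ i₂ i₃ d₁₂ d₁₃ d₂₃ hcover hW hw hw' hww'
  have := he (w' - w)
  omega

end Bridge

section Product

variable {m l : ℕ} [NeZero m] [NeZero l]

omit [NeZero m] in
/-- In `ℤ_m × ℤ_l` with `m ∣ l` every element has order at most `l`. [folklore] -/
theorem addOrderOf_le_of_zmod_prod (hml : m ∣ l) (x : ZMod m × ZMod l) : addOrderOf x ≤ l := by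
  have hl : 0 < l := Nat.pos_of_ne_zero (NeZero.ne l)
  refine Nat.le_of_dvd hl (addOrderOf_dvd_iff_nsmul_eq_zero.2 ?_)
  have h0 : ((l : ℕ) : ZMod m) = 0 := (ZMod.natCast_eq_zero_iff l m).2 hml
  ext <;> simp [nsmul_eq_mul, h0]

/-- **No part of size three over `ℤ_m × ℤ_l`, `m ∣ l`, `m ≥ 7`** (kernel; e.g. `ℤ_7 × ℤ_49`, `ℤ_7 × ℤ_112`, and every
`ℤ_m × ℤ_{mk}` with `m ≥ 7`): the exponent is `l` and `6l + 4 < 7l ≤ ml = |A|`. [folklore] -/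
theorem cube_form_no_part_three_zmod_prod (hml : m ∣ l) (hm : 7 ≤ m) {W X Y : Finset (ZMod m × ZMod l)}
    {x₀ : ZMod m × ZMod l}
    (h₁ : Set.InjOn (fun q : (ZMod m × ZMod l) × (ZMod m × ZMod l) × (ZMod m × ZMod l) => -q.1 + q.2.1 + q.2.2)
      ↑(W ×ˢ X ×ˢ Y))
    (h₂ : Set.InjOn (fun q : (ZMod m × ZMod l) × (ZMod m × ZMod l) × (ZMod m × ZMod l) => q.1 - q.2.1 + q.2.2)
      ↑(W ×ˢ X ×ˢ Y))
    (h₃ : Set.InjOn (fun q : (ZMod m × ZMod l) × (ZMod m × ZMod l) × (ZMod m × ZMod l) => q.1 + q.2.1 - q.2.2)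
      ↑(W ×ˢ X ×ˢ Y))
    (d₁₂ : Disjoint ((W ×ˢ X ×ˢ Y).image fun q => -q.1 + q.2.1 + q.2.2) ((W ×ˢ X ×ˢ Y).image fun q => q.1 - q.2.1 + q.2.2))
    (d₁₃ : Disjoint ((W ×ˢ X ×ˢ Y).image fun q => -q.1 + q.2.1 + q.2.2) ((W ×ˢ X ×ˢ Y).image fun q => q.1 + q.2.1 - q.2.2))
    (d₂₃ : Disjoint ((W ×ˢ X ×ˢ Y).image fun q => q.1 - q.2.1 + q.2.2) ((W ×ˢ X ×ˢ Y).image fun q => q.1 + q.2.1 - q.2.2))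
    (hcover : ((W ×ˢ X ×ˢ Y).image fun q => -q.1 + q.2.1 + q.2.2) ∪ ((W ×ˢ X ×ˢ Y).image fun q => q.1 - q.2.1 + q.2.2) ∪
      ((W ×ˢ X ×ˢ Y).image fun q => q.1 + q.2.1 - q.2.2) = univ.erase x₀) :
    W.card ≠ 3 ∧ X.card ≠ 3 ∧ Y.card ≠ 3 := by
  have hcard : Fintype.card (ZMod m × ZMod l) = m * l := by rw [Fintype.card_prod, ZMod.card, ZMod.card]
  have hl : 7 ≤ l := le_trans hm (Nat.le_of_dvd (Nat.pos_of_ne_zero (NeZero.ne l)) hml)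
  exact cube_form_no_part_three_of_addOrderOf_le_six h₁ h₂ h₃ d₁₂ d₁₃ d₂₃ hcover l (addOrderOf_le_of_zmod_prod hml)
    (by rw [hcard]; nlinarith)

end Product

end Summit.MatrixMultiplication.OmegaCensus
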